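import Summits.RiemannHypothesis.RiemannHypothesis.Theorems.WeilWindowFlowDiniLeakageRelEdgeMassLaw
import Summits.RiemannHypothesis.RiemannHypothesis.Theorems.WeilGroundStateGroundStatesConvergeToXiEnergySubexp

/-!
# Crux-strategist sketch for `WeilWindowFlow.DiniLeakage` (stmt-RiemannHypothesis-1038) — typed attempts
(planner-cstrat-stmt-RiemannHypothesis-1038-p1-0, 2026-08-17; EVIDENCE for STRATEGY-CENSUS.md, not a line)

The crux is the summit verbatim (`diniLeakage_iff_mathlib_riemannHypothesis`, p90716).  This file types the
census's concrete attempts so that "attempted-with-result" is kernel-checked where it can be: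

* §D2 thermometer dichotomy — the best typed split `ThermometerFloor θ₀ ∧ BlowdownGap θ₀ → DiniLeakage`
  (glue `DiniLeakage_of_floor_of_gap`, sorry-free), plus the calibrations: both leaves are RH-implied
  (`thermometerFloor_of_riemannHypothesis`, `blowdownGap_of_riemannHypothesis`), and the floor leaf is a
  zero-free STRIP by a tree theorem (`strip_of_thermometerFloor`, via
  `abs_re_sub_half_le_of_weilGroundEnergy_ge_neg_exp`) — i.e. route Strip's crux in window language.
* §S2 the convexity barrier — `LogConvexWindow` (log ε convex in μ = e^{2a} on its positivity range) as a
  signature, with the elementary barrier lemma `DiniLeakage_of_logConvexWindow` left as a `sorry`d remark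
  (the census explains why this S⁺ is structurally false: concave cusps at prime-power entries).
-/

noncomputable section

set_option linter.dupNamespace false

namespace Summit.RiemannHypothesis.RiemannHypothesis.Cruxes.DiniLeakage.Strategist

open _root_.Literature.NumberTheory.LFunctions
open _root_.Summit.RiemannHypothesis.RiemannHypothesis.Theses.WeilWindowFlow (DiniLeakage)
open _root_.Summit.RiemannHypothesis.RiemannHypothesis.Theorems.WeilWindowFlowDiniLeakage
  (diniLeakage_iff_mathlib_riemannHypothesis)

/-! ## §D2 — thermometer dichotomy (Decomposition attempt) -/

/-- Sub₁, THERMOMETER FLOOR at exponent `θ₀`: the window bottom never sinks below `-C·exp(2θ₀a)`.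
`θ₀ = 1/2` is the trivial geometric-side bound; `θ₀ < 1/2` is a zero-free strip (`strip_of_thermometerFloor`). -/
def ThermometerFloor (θ₀ : ℝ) : Prop :=
  ∃ C : ℝ, ∀ a : ℝ, 0 < a → -(C * Real.exp (2 * θ₀ * a)) ≤ weilGroundEnergy a

/-- Sub₂, BLOW-DOWN GAP at exponent `θ₀`: negativity, once present at some window, is amplified by the
window flow at an exponential rate strictly above `2θ₀`. -/
def BlowdownGap (θ₀ : ℝ) : Prop :=
  (∃ a : ℝ, 0 < a ∧ weilGroundEnergy a < 0) →
    ∃ θ₁ c a₁ : ℝ, θ₀ < θ₁ ∧ 0 < c ∧ ∀ a : ℝ, a₁ ≤ a → weilGroundEnergy a ≤ -(c * Real.exp (2 * θ₁ * a))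

/-- The two leaves force `ε ≥ 0` at every window (elementary: `c e^{2θ₁a} ≤ -ε(a) ≤ C e^{2θ₀a}` is absurd
for large `a` when `θ₁ > θ₀`). -/
theorem forall_nonneg_of_floor_of_gap {θ₀ : ℝ} (h₁ : ThermometerFloor θ₀) (h₂ : BlowdownGap θ₀) :
    ∀ a : ℝ, 0 < a → 0 ≤ weilGroundEnergy a := by
  by_contra hneg
  push Not at hneg
  obtain ⟨a₀, ha₀, hlt⟩ := hneg
  obtain ⟨C, hC⟩ := h₁
  obtain ⟨θ₁, c, a₁, hθ, hc, hgap⟩ := h₂ ⟨a₀, ha₀, hlt⟩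
  set d : ℝ := 2 * (θ₁ - θ₀) with hd
  have hdpos : 0 < d := by rw [hd]; linarith
  set a : ℝ := max a₁ (max 1 ((C / c - 1) / d + 1)) with ha_def
  have ha₁ : a₁ ≤ a := le_max_left _ _
  have ha1 : (1 : ℝ) ≤ a := (le_max_left _ _).trans (le_max_right _ _)
  have hapos : 0 < a := by linarith
  have habig : (C / c - 1) / d + 1 ≤ a := (le_max_right _ _).trans (le_max_right _ _)
  have hlow := hC a hapos
  have hup := hgap a ha₁
  have hcomb : c * Real.exp (2 * θ₁ * a) ≤ C * Real.exp (2 * θ₀ * a) := by linarith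
  have hsplit : Real.exp (2 * θ₁ * a) = Real.exp (2 * θ₀ * a) * Real.exp (d * a) := by
    rw [← Real.exp_add]; congr 1; rw [hd]; ring
  have hE : 0 < Real.exp (2 * θ₀ * a) := Real.exp_pos _
  have hkey : c * Real.exp (d * a) ≤ C := by
    rw [hsplit] at hcomb
    have h' : (c * Real.exp (d * a)) * Real.exp (2 * θ₀ * a) ≤ C * Real.exp (2 * θ₀ * a) := by
      calc (c * Real.exp (d * a)) * Real.exp (2 * θ₀ * a)
          = c * (Real.exp (2 * θ₀ * a) * Real.exp (d * a)) := by ring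
        _ ≤ C * Real.exp (2 * θ₀ * a) := hcomb
    exact le_of_mul_le_mul_right h' hE
  have hexp : d * a + 1 ≤ Real.exp (d * a) := Real.add_one_le_exp _
  have h1 : c * (d * a + 1) ≤ C := (mul_le_mul_of_nonneg_left hexp hc.le).trans hkey
  have h2 : d * a + 1 ≤ C / c := by
    rw [le_div_iff₀ hc]; linarith
  have h3 : a ≤ (C / c - 1) / d := by
    rw [le_div_iff₀ hdpos]; linarith
  linarith

/-- **Glue of the split (kernel-checked):** `Sub₁ → Sub₂ → crux`, through Weil's criterion
(`riemannHypothesis_iff_forall_weilPositivityOn`, `weilGroundEnergy_nonneg_iff_holds`) and the calibration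
`diniLeakage_iff_mathlib_riemannHypothesis`. -/
theorem DiniLeakage_of_floor_of_gap {θ₀ : ℝ} (h₁ : ThermometerFloor θ₀) (h₂ : BlowdownGap θ₀) :
    DiniLeakage := by
  have hpos := forall_nonneg_of_floor_of_gap h₁ h₂
  have hRH : _root_.RiemannHypothesis :=
    riemannHypothesis_iff_forall_weilPositivityOn.2 fun a ha ↦
      (weilGroundEnergy_nonneg_iff_holds ha).1 (hpos a ha)
  exact diniLeakage_iff_mathlib_riemannHypothesis.2 hRH

/-- Calibration 1: the floor leaf is RH-implied (every leaf of a split of RH is). -/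
theorem thermometerFloor_of_riemannHypothesis (hRH : _root_.RiemannHypothesis) (θ₀ : ℝ) :
    ThermometerFloor θ₀ := by
  refine ⟨1, fun a ha ↦ ?_⟩
  have h0 : 0 ≤ weilGroundEnergy a :=
    (weilGroundEnergy_nonneg_iff_holds ha).2 (riemannHypothesis_iff_forall_weilPositivityOn.1 hRH a ha)
  have : 0 < 1 * Real.exp (2 * θ₀ * a) := by positivity
  linarith

/-- Calibration 2: the gap leaf is RH-implied (vacuously: under RH no window is negative). -/
theorem blowdownGap_of_riemannHypothesis (hRH : _root_.RiemannHypothesis) (θ₀ : ℝ) :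
    BlowdownGap θ₀ := by
  rintro ⟨a, ha, hlt⟩
  have h0 : 0 ≤ weilGroundEnergy a :=
    (weilGroundEnergy_nonneg_iff_holds ha).2 (riemannHypothesis_iff_forall_weilPositivityOn.1 hRH a ha)
  exact absurd hlt (not_lt.2 h0)

/-- Calibration 3: **the floor leaf IS a zero-free strip** (tree theorem
`abs_re_sub_half_le_of_weilGroundEnergy_ge_neg_exp`, route WeilGroundState): `ThermometerFloor θ₀` with
`0 ≤ θ₀` confines every non-trivial zero to `|Re ρ − 1/2| ≤ 2θ₀` — for `θ₀ < 1/4` this is quasi-RH, route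
Strip's crux (the tree's exponent is not sharp: the two-bump witness gives `≤ θ₀`). -/
theorem strip_of_thermometerFloor {θ₀ : ℝ} (hθ : 0 ≤ θ₀) (h : ThermometerFloor θ₀) {ρ : ℂ}
    (hρ : ρ ∈ ZetaZeros.riemannZetaNontrivialZeros) : |ρ.re - 1 / 2| ≤ 2 * θ₀ := by
  obtain ⟨C, hC⟩ := h
  exact _root_.Summit.RiemannHypothesis.RiemannHypothesis.Theorems.GroundStatesConvergeToXi.abs_re_sub_half_le_of_weilGroundEnergy_ge_neg_exp
    (K := C) (δ := 2 * θ₀) (by positivity) (fun a ha ↦ by simpa [mul_assoc] using hC a ha) hρ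

/-! ## §S2 — the convexity barrier (Strengthen attempt; signature only) -/

/-- S⁺₂, LOG-CONVEX WINDOW: on every window range `[b, c] ⊂ (0, ∞)` on which `ε > 0`, `log ε` is convex
as a function of `μ = e^{2a}` (stated through `a = (log μ)/2`).  PINNED (no free constant), LOCAL in the
window, and by the convex-barrier argument it excludes conjugate points, hence gives RH.  The census
(§Strengthen) records why it is false: `(log ε)'' → −∞` at every prime-power entry `a = (log n)/2`. -/
def LogConvexWindow : Prop :=
  ∀ b c : ℝ, 0 < b → b ≤ c → (∀ a ∈ Set.Icc b c, 0 < weilGroundEnergy a) →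
    ConvexOn ℝ (Set.Icc (Real.exp (2 * b)) (Real.exp (2 * c)))
      (fun μ : ℝ ↦ Real.log (weilGroundEnergy (Real.log μ / 2)))

end Summit.RiemannHypothesis.RiemannHypothesis.Cruxes.DiniLeakage.Strategist

end
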